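import Mathlib.Analysis.SpecialFunctions.Trigonometric.Deriv
import Literature.Analysis.FluidPDE.LocalBiotSavartCalculus
import Literature.Analysis.FluidPDE.PressurePoisson
import HarnessLib

/-!
# The Taylor–Green vortex: initial velocity, vorticity, initial pressure and initial
# acceleration in closed form (Taylor–Green 1937; Brachet et al. 1983; van Rees et al. 2011;
# DeBonis 2013)

Literature file (topic `Analysis/FluidPDE`): the initial datum of the Taylor–Green vortex benchmark,
typed as a vector field on `ℝ³ = EuclideanSpace ℝ (Fin 3)` with the tree's `curl`,
`VectorCalculus.divergence`, `convect`, Mathlib's `gradient` and Laplacian `Δ`. All statements are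
theorems (closed-form trigonometric identities); no named facts.

## The printed statements

* G. I. Taylor, A. E. Green, *Mechanism of the production of small eddies from large ones*, Proc.
  R. Soc. A 158 (1937) 499–521: the initial motion `u = A cos ax sin by sin cz`,
  `v = B sin ax cos by sin cz`, `w = C sin ax sin by cos cz` (12), consistent iff `Aa + Bb + Cc = 0`
  (13); eliminating `∂u/∂t, ∂v/∂t, ∂w/∂t` between the equations of motion and continuity gives
  the Poisson equation for the initial pressure, `−∇²P/ρ = …` (15)–(16), "The periodic solution of
  (16) is" (17), and "Substituting for `u, v, w` and `P` from (12) and (17) in (14) gives the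
  initial value of `∂u/∂t`" (18)–(19) — a viscous term `−ν(a² + b² + c²)u` plus a term in
  `sin 2ax cos 2cz`, `sin 2ax cos 2by`.
* The member used as THE Taylor–Green vortex benchmark (Brachet et al., J. Fluid Mech. 130 (1983),
  eq. (1.1); van Rees et al., J. Comput. Phys. 230 (2011) §3 eq. (10) with `θ = 0`; DeBonis, AIAA
  2013-0382, eqs. (7)–(10) with `V₀ = L = ρ₀ = 1`): on the `2π`-periodic box,
  `u = sin x cos y cos z`, `v = −cos x sin y cos z`, `w = 0`, with the initial pressure
  `p = p₀ + (ρ₀V₀²/16)(cos 2x + cos 2y)(cos 2z + 2)` (DeBonis eq. (10)).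

## What is formalised (namespace `TaylorGreenVortex`; coordinates `x 0, x 1, x 2` for `x, y, z`)

* `velocity` (the datum), `vorticity` (`(−cos x sin y sin z, −sin x cos y sin z, 2 sin x sin y cos z)`),
  `pressure` (`(1/16)(cos 2x + cos 2y)(cos 2z + 2)`), `pressureGradient`, `convectField`
  (`(u·∇)u = (½ sin 2x cos²z, ½ sin 2y cos²z, 0)`), `projectedNonlinearity`
  (`(u·∇)u + ∇p = (1/8)(sin 2x cos 2z, sin 2y cos 2z, −sin 2z (cos 2x + cos 2y))`);
* `contDiff_velocity`, **`isDivFree_velocity`** (T–G (13): `1·1 + (−1)·1 + 0 = 0`),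
  **`curl_velocity`** (`curl u = ω`), `curl_vorticity` (`curl ω = 3u`), **`laplacian_velocity`**
  (`Δu = −3u`: the datum lives on the shell `|k|² = 3`), **`convect_velocity`**,
  **`gradient_pressure`**, **`convect_add_gradient_pressure`**,
  **`divergence_convect_add_gradient_pressure`** (`div((u·∇)u + ∇p) = 0`: the printed `p` solves
  the pressure Poisson equation — equivalently **`laplacian_pressure`**:
  `Δp = −½(cos 2x + cos 2y)(1 + cos 2z) = −div((u·∇)u)`, T–G (15)–(17)), and
  **`initialAcceleration_eq`**: `νΔu − ((u·∇)u + ∇p) = −3νu − (1/8)(sin 2x cos 2z, sin 2y cos 2z,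
  −sin 2z (cos 2x + cos 2y))` — the right-hand side of the Navier–Stokes momentum equation at
  `t = 0` for this datum and pressure (T–G (18)–(19) for this member), i.e. the initial `∂ₜu` of
  the periodic solution.

Relation to the tree: `Literature/Analysis/FluidPDE/FluidComputer/ClassicalLatticeData`
(`TaylorGreen.u/v/w x y z`) records the same datum as three scalar functions of three real
variables with one-variable derivatives (`div_eq_zero`, `laplacian_u/v/w`, sup norms) for the
FLUID COMPUTER cell's Galerkin files; the present file is the vector-field form on
`EuclideanSpace ℝ (Fin 3)` with the tree's `curl`/`convect`/`gradient`, and adds the pressure,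
the nonlinear term and the initial acceleration, which no tree file states. Not formalised: the
time evolution (T–G's series (12)–(43) in `t`, Brachet et al.'s small-time expansion), means over
the period cell, the general family (12) with `(A, B, C, a, b, c)`. HONEST FRAMING (cell
`pub-fluidc`, gate G1 datum): typed infrastructure for a low prior, high value-of-information
experiment on Tao's machine paradigm; NOT a claim that NS blows up.

## References

* [TaylorGreen1937] G. I. Taylor, A. E. Green, Proc. R. Soc. Lond. A 158 (1937) 499–521,
  eqs. (12)–(19).
* [BrachetEtAl1983] M. E. Brachet, D. I. Meiron, S. A. Orszag, B. G. Nickel, R. H. Morf,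
  U. Frisch, Small-scale structure of the Taylor–Green vortex, J. Fluid Mech. 130 (1983) 411–452,
  eq. (1.1).
* [VanReesEtAl2011VortexSpectral] W. M. van Rees, A. Leonard, D. I. Pullin, P. Koumoutsakos,
  J. Comput. Phys. 230 (2011) 2794–2805, §3 eq. (10).
* [DeBonis2013TaylorGreen] J. R. DeBonis, Solutions of the Taylor–Green vortex problem using
  high-resolution explicit finite difference methods, AIAA 2013-0382, eqs. (7)–(10).
-/

noncomputable section

open Real Set Function InnerProductSpace
open scoped RealInnerProductSpace ContDiff Laplacian Topology

namespace Literature.Analysis.FluidPDE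

/-- Local notation for physical space `ℝ³ = EuclideanSpace ℝ (Fin 3)`. -/
local notation "ℝ³" => EuclideanSpace ℝ (Fin 3)

/-- Local notation for the standard basis vectors. -/
local notation "𝐞" j => EuclideanSpace.single (j : Fin 3) (1 : ℝ)

namespace TaylorGreenVortex

/-! ### The data -/

/-- **The Taylor–Green initial velocity** `u = (sin x cos y cos z, −cos x sin y cos z, 0)`.
[cite: VanReesEtAl2011VortexSpectral, §3 eq. (10)] [cite: BrachetEtAl1983, eq. (1.1)] [cite: TaylorGreen1937, eq. (12)] -/
def velocity (x : ℝ³) : ℝ³ :=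
  !₂[sin (x 0) * cos (x 1) * cos (x 2), -(cos (x 0) * sin (x 1) * cos (x 2)), 0]

/-- **The Taylor–Green initial vorticity** `ω = curl u = (−cos x sin y sin z, −sin x cos y sin z,
2 sin x sin y cos z)` (see `curl_velocity`). [cite: TaylorGreen1937, eq. (12)] -/
def vorticity (x : ℝ³) : ℝ³ :=
  !₂[-(cos (x 0) * sin (x 1) * sin (x 2)), -(sin (x 0) * cos (x 1) * sin (x 2)),
    2 * sin (x 0) * sin (x 1) * cos (x 2)]

/-- **The Taylor–Green initial pressure** `p = (1/16)(cos 2x + cos 2y)(cos 2z + 2)` (the periodic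
solution of the pressure Poisson equation, additive constant `p₀ = 0`, `ρ₀ = V₀ = 1`).
[cite: DeBonis2013TaylorGreen, eq. (10)] [cite: TaylorGreen1937, eq. (17)] -/
def pressure (x : ℝ³) : ℝ :=
  1 / 16 * (cos (2 * x 0) + cos (2 * x 1)) * (cos (2 * x 2) + 2)

/-- The gradient of the initial pressure in closed form,
`∇p = −(1/8)(sin 2x (cos 2z + 2), sin 2y (cos 2z + 2), sin 2z (cos 2x + cos 2y))` (see `gradient_pressure`).
[cite: TaylorGreen1937, eq. (17)] -/
def pressureGradient (x : ℝ³) : ℝ³ :=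
  !₂[-(1 / 8 * (sin (2 * x 0) * (cos (2 * x 2) + 2))), -(1 / 8 * (sin (2 * x 1) * (cos (2 * x 2) + 2))),
    -(1 / 8 * (sin (2 * x 2) * (cos (2 * x 0) + cos (2 * x 1))))]

/-- The nonlinear term in closed form, `(u·∇)u = (½ sin 2x cos²z, ½ sin 2y cos²z, 0)`
(see `convect_velocity`). [cite: TaylorGreen1937, eqs. (14)–(15)] -/
def convectField (x : ℝ³) : ℝ³ :=
  !₂[1 / 2 * sin (2 * x 0) * cos (x 2) ^ 2, 1 / 2 * sin (2 * x 1) * cos (x 2) ^ 2, 0]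

/-- The divergence-free part of the nonlinearity, `(u·∇)u + ∇p =
(1/8)(sin 2x cos 2z, sin 2y cos 2z, −sin 2z (cos 2x + cos 2y))` (see `convect_add_gradient_pressure`).
[cite: TaylorGreen1937, eqs. (18)–(19)] -/
def projectedNonlinearity (x : ℝ³) : ℝ³ :=
  !₂[1 / 8 * (sin (2 * x 0) * cos (2 * x 2)), 1 / 8 * (sin (2 * x 1) * cos (2 * x 2)),
    -(1 / 8 * (sin (2 * x 2) * (cos (2 * x 0) + cos (2 * x 1))))]

/-! ### Coordinate helpers -/

/-- The coordinate functions `x ↦ x j` are the projections `EuclideanSpace.proj j`. [folklore] -/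
private theorem hasFDerivAt_coord (j : Fin 3) (x : ℝ³) :
    HasFDerivAt (fun y : ℝ³ => y j) (EuclideanSpace.proj j : ℝ³ →L[ℝ] ℝ) x :=
  (EuclideanSpace.proj j : ℝ³ →L[ℝ] ℝ).hasFDerivAt

/-- `d/dx cos(2x) = −2 sin(2x)` along a coordinate. [folklore] -/
private theorem hasFDerivAt_cos_two_mul (j : Fin 3) (x : ℝ³) :
    HasFDerivAt (fun y : ℝ³ => cos (2 * y j))
      ((-(2 * sin (2 * x j))) • (EuclideanSpace.proj j : ℝ³ →L[ℝ] ℝ)) x := by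
  have h := ((Real.hasDerivAt_cos (2 * x j)).comp (x j) ((hasDerivAt_id (x j)).const_mul 2))
    |>.comp_hasFDerivAt x (hasFDerivAt_coord j x)
  refine h.congr_fderiv ?_
  ext w
  simp [mul_comm]

/-- `d/dx sin(2x) = 2 cos(2x)` along a coordinate. [folklore] -/
private theorem hasFDerivAt_sin_two_mul (j : Fin 3) (x : ℝ³) :
    HasFDerivAt (fun y : ℝ³ => sin (2 * y j))
      ((2 * cos (2 * x j)) • (EuclideanSpace.proj j : ℝ³ →L[ℝ] ℝ)) x := by
  have h := ((Real.hasDerivAt_sin (2 * x j)).comp (x j) ((hasDerivAt_id (x j)).const_mul 2))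
    |>.comp_hasFDerivAt x (hasFDerivAt_coord j x)
  refine h.congr_fderiv ?_
  ext w
  simp [mul_comm]

/-- The coordinates of the gradient: `(∇ψ)(y) i = Dψ(y) eᵢ`. [folklore] -/
private theorem gradient_apply_coord (ψ : ℝ³ → ℝ) (y : ℝ³) (i : Fin 3) :
    gradient ψ y i = fderiv ℝ ψ y (𝐞 i) := by
  have h := InnerProductSpace.toDual_symm_apply (x := (𝐞 i)) (y := fderiv ℝ ψ y) (𝕜 := ℝ) (E := ℝ³)
  rw [EuclideanSpace.inner_single_right] at h
  simpa [gradient] using h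

/-- The linear map of `ℝ³` with Jacobian table `M` (row `j` = direction `∂ⱼ`, column `i` =
component): `L w = Σᵢ (Σⱼ M j i · wⱼ) eᵢ`, so that `(L eⱼ)ᵢ = M j i`. [folklore] -/
private def clmOfJac (M : Fin 3 → Fin 3 → ℝ) : ℝ³ →L[ℝ] ℝ³ :=
  ∑ i : Fin 3, (∑ j : Fin 3, M j i • (EuclideanSpace.proj j : ℝ³ →L[ℝ] ℝ)).smulRight (𝐞 i)

/-- The entries of `clmOfJac M`: `(L eⱼ)ᵢ = M j i`. [folklore] -/
private theorem clmOfJac_single (M : Fin 3 → Fin 3 → ℝ) (j i : Fin 3) :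
    clmOfJac M (𝐞 j) i = M j i := by
  fin_cases j <;> fin_cases i <;>
    simp [clmOfJac, Fin.sum_univ_three, ContinuousLinearMap.smulRight_apply]

/-- `clmOfJac M` applied to a general vector, componentwise. [folklore] -/
private theorem clmOfJac_apply (M : Fin 3 → Fin 3 → ℝ) (w : ℝ³) (i : Fin 3) :
    clmOfJac M w i = ∑ j : Fin 3, M j i * w j := by
  fin_cases i <;>
    simp [clmOfJac, Fin.sum_univ_three, ContinuousLinearMap.smulRight_apply, mul_comm]

/-! ### The velocity: Jacobian, divergence, curl -/

/-- The Jacobian of the Taylor–Green velocity, row `j` = `∂/∂xⱼ`, column `i` = component.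
[cite: TaylorGreen1937, eq. (12)] -/
def jac (x : ℝ³) : Fin 3 → Fin 3 → ℝ :=
  ![![cos (x 0) * cos (x 1) * cos (x 2), sin (x 0) * sin (x 1) * cos (x 2), 0],
    ![-(sin (x 0) * sin (x 1) * cos (x 2)), -(cos (x 0) * cos (x 1) * cos (x 2)), 0],
    ![-(sin (x 0) * cos (x 1) * sin (x 2)), cos (x 0) * sin (x 1) * sin (x 2), 0]]

/-- The velocity as a combination of the standard basis vectors. [folklore] -/
private theorem velocity_eq (x : ℝ³) :
    velocity x = (sin (x 0) * cos (x 1) * cos (x 2)) • (𝐞 0) +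
      (-(cos (x 0) * sin (x 1) * cos (x 2))) • (𝐞 1) := by
  ext i
  fin_cases i <;> simp [velocity]

/-- The derivative of the Taylor–Green velocity. [folklore] -/
private theorem hasFDerivAt_velocity (x : ℝ³) : HasFDerivAt velocity (clmOfJac (jac x)) x := by
  rw [show velocity = fun y => (sin (y 0) * cos (y 1) * cos (y 2)) • (𝐞 0) +
      (-(cos (y 0) * sin (y 1) * cos (y 2))) • (𝐞 1) from funext velocity_eq]
  have s0 := (hasFDerivAt_coord 0 x).sin
  have c0 := (hasFDerivAt_coord 0 x).cos
  have s1 := (hasFDerivAt_coord 1 x).sin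
  have c1 := (hasFDerivAt_coord 1 x).cos
  have c2 := (hasFDerivAt_coord 2 x).cos
  have hu := ((s0.mul c1).mul c2).smul_const (𝐞 0)
  have hv := ((c0.mul s1).mul c2).neg.smul_const (𝐞 1)
  refine (hu.add hv).congr_fderiv ?_
  ext w i
  fin_cases i <;> simp [clmOfJac_apply, jac, Fin.sum_univ_three] <;> ring

/-- `∂ⱼ uᵢ` of the Taylor–Green velocity. [cite: TaylorGreen1937, eq. (12)] -/
theorem fderiv_velocity_single (x : ℝ³) (j i : Fin 3) :
    fderiv ℝ velocity x (𝐞 j) i = jac x j i := by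
  rw [(hasFDerivAt_velocity x).fderiv, clmOfJac_single]

/-- The Taylor–Green velocity is smooth. [cite: VanReesEtAl2011VortexSpectral, §3 eq. (10)] -/
theorem contDiff_velocity {n : WithTop ℕ∞} : ContDiff ℝ n velocity := by
  have hc : ∀ j : Fin 3, ContDiff ℝ n (fun y : ℝ³ => y j) := fun j =>
    (EuclideanSpace.proj j : ℝ³ →L[ℝ] ℝ).contDiff
  rw [show velocity = fun y => (sin (y 0) * cos (y 1) * cos (y 2)) • (𝐞 0) +
      (-(cos (y 0) * sin (y 1) * cos (y 2))) • (𝐞 1) from funext velocity_eq]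
  exact ((((hc 0).sin.mul (hc 1).cos).mul (hc 2).cos).smul contDiff_const).add
    ((((hc 0).cos.mul (hc 1).sin).mul (hc 2).cos).neg.smul contDiff_const)

/-- The Taylor–Green velocity is differentiable. [cite: VanReesEtAl2011VortexSpectral, §3 eq. (10)] -/
theorem differentiable_velocity : Differentiable ℝ velocity := fun x =>
  (hasFDerivAt_velocity x).differentiableAt

/-- **The Taylor–Green datum is divergence free** (`cos x cos y cos z − cos x cos y cos z + 0 = 0`;
T–G's consistency condition (13) `Aa + Bb + Cc = 0`).
[cite: TaylorGreen1937, eq. (13)] [cite: VanReesEtAl2011VortexSpectral, §3 eq. (10)] -/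
theorem isDivFree_velocity : VectorCalculus.IsDivFree velocity := fun x => by
  rw [VectorCalculus.divergence, trace_eq_sum_coord, Fin.sum_univ_three,
    fderiv_velocity_single, fderiv_velocity_single, fderiv_velocity_single]
  simp [jac]

/-- **The Taylor–Green initial vorticity**: `curl u = (−cos x sin y sin z, −sin x cos y sin z,
2 sin x sin y cos z)`. [cite: TaylorGreen1937, eq. (12)] [cite: BrachetEtAl1983, eq. (1.1)] -/
theorem curl_velocity (x : ℝ³) : curl velocity x = vorticity x := by
  rw [curl_eq_curlCLM, curlCLM_apply]
  simp only [fderiv_velocity_single]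
  ext i
  fin_cases i
  · simp [jac, vorticity]
  · simp [jac, vorticity]
  · simp [jac, vorticity]; ring

/-! ### The vorticity: Jacobian and curl; `Δu = −3u` -/

/-- The Jacobian of the Taylor–Green vorticity, row `j` = `∂/∂xⱼ`, column `i` = component.
[cite: TaylorGreen1937, eq. (12)] -/
def jacVorticity (x : ℝ³) : Fin 3 → Fin 3 → ℝ :=
  ![![sin (x 0) * sin (x 1) * sin (x 2), -(cos (x 0) * cos (x 1) * sin (x 2)), 2 * cos (x 0) * sin (x 1) * cos (x 2)],
    ![-(cos (x 0) * cos (x 1) * sin (x 2)), sin (x 0) * sin (x 1) * sin (x 2), 2 * sin (x 0) * cos (x 1) * cos (x 2)],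
    ![-(cos (x 0) * sin (x 1) * cos (x 2)), -(sin (x 0) * cos (x 1) * cos (x 2)), -(2 * sin (x 0) * sin (x 1) * sin (x 2))]]

/-- The vorticity as a combination of the standard basis vectors. [folklore] -/
private theorem vorticity_eq (x : ℝ³) :
    vorticity x = (-(cos (x 0) * sin (x 1) * sin (x 2))) • (𝐞 0) +
      (-(sin (x 0) * cos (x 1) * sin (x 2))) • (𝐞 1) + (2 * sin (x 0) * sin (x 1) * cos (x 2)) • (𝐞 2) := by
  ext i
  fin_cases i <;> simp [vorticity]

/-- The derivative of the Taylor–Green vorticity. [folklore] -/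
private theorem hasFDerivAt_vorticity (x : ℝ³) : HasFDerivAt vorticity (clmOfJac (jacVorticity x)) x := by
  rw [show vorticity = fun y => (-(cos (y 0) * sin (y 1) * sin (y 2))) • (𝐞 0) +
      (-(sin (y 0) * cos (y 1) * sin (y 2))) • (𝐞 1) + (2 * sin (y 0) * sin (y 1) * cos (y 2)) • (𝐞 2)
      from funext vorticity_eq]
  have s0 := (hasFDerivAt_coord 0 x).sin
  have c0 := (hasFDerivAt_coord 0 x).cos
  have s1 := (hasFDerivAt_coord 1 x).sin
  have c1 := (hasFDerivAt_coord 1 x).cos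
  have s2 := (hasFDerivAt_coord 2 x).sin
  have c2 := (hasFDerivAt_coord 2 x).cos
  have h0 := ((c0.mul s1).mul s2).neg.smul_const (𝐞 0)
  have h1 := ((s0.mul c1).mul s2).neg.smul_const (𝐞 1)
  have h2 := (((s0.const_mul 2).mul s1).mul c2).smul_const (𝐞 2)
  refine ((h0.add h1).add h2).congr_fderiv ?_
  ext w i
  fin_cases i <;> simp [clmOfJac_apply, jacVorticity, Fin.sum_univ_three] <;> ring

/-- `∂ⱼ ωᵢ` of the Taylor–Green vorticity. [cite: TaylorGreen1937, eq. (12)] -/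
theorem fderiv_vorticity_single (x : ℝ³) (j i : Fin 3) :
    fderiv ℝ vorticity x (𝐞 j) i = jacVorticity x j i := by
  rw [(hasFDerivAt_vorticity x).fderiv, clmOfJac_single]

/-- **`curl ω = 3u`** for the Taylor–Green datum (so that `−Δu = curl curl u = 3u`).
[cite: TaylorGreen1937, eq. (12)] -/
theorem curl_vorticity (x : ℝ³) : curl vorticity x = (3 : ℝ) • velocity x := by
  rw [curl_eq_curlCLM, curlCLM_apply]
  simp only [fderiv_vorticity_single]
  ext i
  fin_cases i
  · simp [jacVorticity, velocity]; ring
  · simp [jacVorticity, velocity]; ring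
  · simp [jacVorticity, velocity]

/-- **`Δu = −3u`**: the Taylor–Green datum is an eigenfunction of the vector Laplacian (all its
energy sits on the shell `|k|² = 3`; the viscous term of T–G (18) is `−ν(a² + b² + c²)u = −3νu`).
[cite: TaylorGreen1937, eq. (18)] -/
theorem laplacian_velocity (x : ℝ³) : (Δ velocity) x = -(3 : ℝ) • velocity x := by
  rw [laplacian_eq_neg_curl_curl contDiff_velocity isDivFree_velocity x,
    show curl velocity = vorticity from funext curl_velocity, curl_vorticity, neg_smul]

/-! ### The nonlinear term and the initial pressure -/

/-- **The nonlinear term**: `(u·∇)u = (½ sin 2x cos²z, ½ sin 2y cos²z, 0)`.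
[cite: TaylorGreen1937, eqs. (14)–(15)] -/
theorem convect_velocity (x : ℝ³) : convect velocity velocity x = convectField x := by
  rw [convect_apply]
  ext i
  rw [clm_apply_coord]
  simp only [Fin.sum_univ_three, fderiv_velocity_single]
  fin_cases i
  · simp [jac, velocity, convectField, Real.sin_two_mul]
    linear_combination (sin (x 0) * cos (x 0) * cos (x 2) ^ 2) * Real.sin_sq_add_cos_sq (x 1)
  · simp [jac, velocity, convectField, Real.sin_two_mul]
    linear_combination (sin (x 1) * cos (x 1) * cos (x 2) ^ 2) * Real.sin_sq_add_cos_sq (x 0)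
  · simp [jac, velocity, convectField]

/-- The derivative of the initial pressure. [folklore] -/
private theorem hasFDerivAt_pressure (x : ℝ³) :
    HasFDerivAt pressure
      ((-(1 / 8 * (sin (2 * x 0) * (cos (2 * x 2) + 2)))) • (EuclideanSpace.proj (0 : Fin 3) : ℝ³ →L[ℝ] ℝ) +
        (-(1 / 8 * (sin (2 * x 1) * (cos (2 * x 2) + 2)))) • (EuclideanSpace.proj (1 : Fin 3) : ℝ³ →L[ℝ] ℝ) +
        (-(1 / 8 * (sin (2 * x 2) * (cos (2 * x 0) + cos (2 * x 1))))) •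
          (EuclideanSpace.proj (2 : Fin 3) : ℝ³ →L[ℝ] ℝ)) x := by
  rw [show pressure = fun y : ℝ³ => 1 / 16 * (cos (2 * y 0) + cos (2 * y 1)) * (cos (2 * y 2) + 2)
      from rfl]
  have h := (((hasFDerivAt_cos_two_mul 0 x).add (hasFDerivAt_cos_two_mul 1 x)).const_mul (1 / 16)).mul
    ((hasFDerivAt_cos_two_mul 2 x).add_const 2)
  refine h.congr_fderiv ?_
  ext w
  simp
  ring

/-- The initial pressure is smooth. [cite: DeBonis2013TaylorGreen, eq. (10)] -/
theorem contDiff_pressure {n : WithTop ℕ∞} : ContDiff ℝ n pressure := by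
  have hc : ∀ j : Fin 3, ContDiff ℝ n (fun y : ℝ³ => y j) := fun j =>
    (EuclideanSpace.proj j : ℝ³ →L[ℝ] ℝ).contDiff
  have h2 : ∀ j : Fin 3, ContDiff ℝ n (fun y : ℝ³ => cos (2 * y j)) := fun j =>
    (contDiff_const.mul (hc j)).cos
  exact (contDiff_const.mul ((h2 0).add (h2 1))).mul ((h2 2).add contDiff_const)

/-- **The gradient of the initial pressure**:
`∇p = −(1/8)(sin 2x (cos 2z + 2), sin 2y (cos 2z + 2), sin 2z (cos 2x + cos 2y))`.
[cite: DeBonis2013TaylorGreen, eq. (10)] [cite: TaylorGreen1937, eq. (17)] -/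
theorem gradient_pressure (x : ℝ³) : gradient pressure x = pressureGradient x := by
  ext i
  rw [gradient_apply_coord, (hasFDerivAt_pressure x).fderiv]
  fin_cases i <;> simp [pressureGradient]

/-- **`(u·∇)u + ∇p = (1/8)(sin 2x cos 2z, sin 2y cos 2z, −sin 2z (cos 2x + cos 2y))`** — the part
of the nonlinearity that survives the pressure projection (T–G (18)–(19), this member).
[cite: TaylorGreen1937, eqs. (18)–(19)] -/
theorem convect_add_gradient_pressure (x : ℝ³) :
    convect velocity velocity x + gradient pressure x = projectedNonlinearity x := by
  rw [convect_velocity, gradient_pressure]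
  have hc : cos (x 2) ^ 2 = 1 / 2 + cos (2 * x 2) / 2 := by rw [Real.cos_sq]
  ext i
  fin_cases i
  · simp [convectField, pressureGradient, projectedNonlinearity, hc]; ring
  · simp [convectField, pressureGradient, projectedNonlinearity, hc]; ring
  · simp [convectField, pressureGradient, projectedNonlinearity]

/-- The Jacobian of the projected nonlinearity. [folklore] -/
private def jacProj (x : ℝ³) : Fin 3 → Fin 3 → ℝ :=
  ![![1 / 4 * (cos (2 * x 0) * cos (2 * x 2)), 0, 1 / 4 * (sin (2 * x 2) * sin (2 * x 0))],
    ![0, 1 / 4 * (cos (2 * x 1) * cos (2 * x 2)), 1 / 4 * (sin (2 * x 2) * sin (2 * x 1))],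
    ![-(1 / 4 * (sin (2 * x 0) * sin (2 * x 2))), -(1 / 4 * (sin (2 * x 1) * sin (2 * x 2))),
      -(1 / 4 * (cos (2 * x 2) * (cos (2 * x 0) + cos (2 * x 1))))]]

/-- The projected nonlinearity as a combination of the standard basis vectors. [folklore] -/
private theorem projectedNonlinearity_eq (x : ℝ³) :
    projectedNonlinearity x = (1 / 8 * (sin (2 * x 0) * cos (2 * x 2))) • (𝐞 0) +
      (1 / 8 * (sin (2 * x 1) * cos (2 * x 2))) • (𝐞 1) +
      (-(1 / 8 * (sin (2 * x 2) * (cos (2 * x 0) + cos (2 * x 1))))) • (𝐞 2) := by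
  ext i
  fin_cases i <;> simp [projectedNonlinearity]

/-- The derivative of the projected nonlinearity. [folklore] -/
private theorem hasFDerivAt_projectedNonlinearity (x : ℝ³) :
    HasFDerivAt projectedNonlinearity (clmOfJac (jacProj x)) x := by
  rw [show projectedNonlinearity = fun y => (1 / 8 * (sin (2 * y 0) * cos (2 * y 2))) • (𝐞 0) +
      (1 / 8 * (sin (2 * y 1) * cos (2 * y 2))) • (𝐞 1) +
      (-(1 / 8 * (sin (2 * y 2) * (cos (2 * y 0) + cos (2 * y 1))))) • (𝐞 2)
      from funext projectedNonlinearity_eq]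
  have S0 := hasFDerivAt_sin_two_mul 0 x
  have S1 := hasFDerivAt_sin_two_mul 1 x
  have S2 := hasFDerivAt_sin_two_mul 2 x
  have C0 := hasFDerivAt_cos_two_mul 0 x
  have C1 := hasFDerivAt_cos_two_mul 1 x
  have C2 := hasFDerivAt_cos_two_mul 2 x
  have h0 := ((S0.mul C2).const_mul (1 / 8)).smul_const (𝐞 0)
  have h1 := ((S1.mul C2).const_mul (1 / 8)).smul_const (𝐞 1)
  have h2 := ((S2.mul (C0.add C1)).const_mul (1 / 8)).neg.smul_const (𝐞 2)
  refine ((h0.add h1).add h2).congr_fderiv ?_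
  ext w i
  fin_cases i <;> simp [clmOfJac_apply, jacProj, Fin.sum_univ_three] <;> ring

/-- **The printed pressure solves the pressure Poisson equation**: `div((u·∇)u + ∇p) = 0` for the
Taylor–Green datum (T–G: "Eliminating `∂u/∂t`, `∂v/∂t`, `∂w/∂t` between the three equations of
motion and the equation of continuity … The periodic solution of (16) is" (17)).
[cite: TaylorGreen1937, eqs. (15)–(17)] [cite: DeBonis2013TaylorGreen, eq. (10)] -/
theorem divergence_convect_add_gradient_pressure (x : ℝ³) :
    VectorCalculus.divergence (fun y => convect velocity velocity y + gradient pressure y) x = 0 := by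
  rw [show (fun y => convect velocity velocity y + gradient pressure y) = projectedNonlinearity
      from funext convect_add_gradient_pressure,
    VectorCalculus.divergence, trace_eq_sum_coord, Fin.sum_univ_three,
    (hasFDerivAt_projectedNonlinearity x).fderiv, clmOfJac_single, clmOfJac_single, clmOfJac_single]
  simp [jacProj]
  ring

/-- The Jacobian of the nonlinear term. [folklore] -/
private def jacConvect (x : ℝ³) : Fin 3 → Fin 3 → ℝ :=
  ![![cos (2 * x 0) * cos (x 2) ^ 2, 0, 0],
    ![0, cos (2 * x 1) * cos (x 2) ^ 2, 0],
    ![-(sin (2 * x 0) * cos (x 2) * sin (x 2)), -(sin (2 * x 1) * cos (x 2) * sin (x 2)), 0]]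

/-- The nonlinear term as a combination of the standard basis vectors. [folklore] -/
private theorem convectField_eq (x : ℝ³) :
    convectField x = (1 / 2 * sin (2 * x 0) * cos (x 2) ^ 2) • (𝐞 0) +
      (1 / 2 * sin (2 * x 1) * cos (x 2) ^ 2) • (𝐞 1) := by
  ext i
  fin_cases i <;> simp [convectField]

/-- The derivative of the nonlinear term. [folklore] -/
private theorem hasFDerivAt_convectField (x : ℝ³) :
    HasFDerivAt convectField (clmOfJac (jacConvect x)) x := by
  rw [show convectField = fun y => (1 / 2 * sin (2 * y 0) * cos (y 2) ^ 2) • (𝐞 0) +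
      (1 / 2 * sin (2 * y 1) * cos (y 2) ^ 2) • (𝐞 1) from funext convectField_eq]
  have S0 := hasFDerivAt_sin_two_mul 0 x
  have S1 := hasFDerivAt_sin_two_mul 1 x
  have CC := ((hasFDerivAt_coord 2 x).cos).pow 2
  have h0 := ((S0.const_mul (1 / 2)).mul CC).smul_const (𝐞 0)
  have h1 := ((S1.const_mul (1 / 2)).mul CC).smul_const (𝐞 1)
  refine (h0.add h1).congr_fderiv ?_
  ext w i
  fin_cases i <;> simp [clmOfJac_apply, jacConvect, Fin.sum_univ_three] <;> ring

/-- **The divergence of the nonlinear term**: `div (u·∇)u = ∂ᵢuⱼ∂ⱼuᵢ = cos²z (cos 2x + cos 2y)`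
(= `2cos²z (cos²x cos²y − sin²x sin²y)`), the source of T–G's pressure equation (16).
[cite: TaylorGreen1937, eqs. (15)–(16)] -/
theorem divergence_convect_velocity (x : ℝ³) :
    VectorCalculus.divergence (convect velocity velocity) x =
      cos (x 2) ^ 2 * (cos (2 * x 0) + cos (2 * x 1)) := by
  rw [show convect velocity velocity = convectField from funext convect_velocity,
    VectorCalculus.divergence, trace_eq_sum_coord, Fin.sum_univ_three, (hasFDerivAt_convectField x).fderiv,
    clmOfJac_single, clmOfJac_single, clmOfJac_single]
  simp [jacConvect]
  ring

/-- The Jacobian of the pressure gradient (the Hessian of `p`). [folklore] -/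
private def jacGrad (x : ℝ³) : Fin 3 → Fin 3 → ℝ :=
  ![![-(1 / 4 * (cos (2 * x 0) * (cos (2 * x 2) + 2))), 0, 1 / 4 * (sin (2 * x 2) * sin (2 * x 0))],
    ![0, -(1 / 4 * (cos (2 * x 1) * (cos (2 * x 2) + 2))), 1 / 4 * (sin (2 * x 2) * sin (2 * x 1))],
    ![1 / 4 * (sin (2 * x 0) * sin (2 * x 2)), 1 / 4 * (sin (2 * x 1) * sin (2 * x 2)),
      -(1 / 4 * (cos (2 * x 2) * (cos (2 * x 0) + cos (2 * x 1))))]]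

/-- The derivative of the pressure gradient. [folklore] -/
private theorem hasFDerivAt_pressureGradient (x : ℝ³) :
    HasFDerivAt pressureGradient (clmOfJac (jacGrad x)) x := by
  have e : pressureGradient = fun y => (-(1 / 8 * (sin (2 * y 0) * (cos (2 * y 2) + 2)))) • (𝐞 0) +
      (-(1 / 8 * (sin (2 * y 1) * (cos (2 * y 2) + 2)))) • (𝐞 1) +
      (-(1 / 8 * (sin (2 * y 2) * (cos (2 * y 0) + cos (2 * y 1))))) • (𝐞 2) := by
    funext y; ext i; fin_cases i <;> simp [pressureGradient]
  rw [e]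
  have S0 := hasFDerivAt_sin_two_mul 0 x
  have S1 := hasFDerivAt_sin_two_mul 1 x
  have S2 := hasFDerivAt_sin_two_mul 2 x
  have C0 := hasFDerivAt_cos_two_mul 0 x
  have C1 := hasFDerivAt_cos_two_mul 1 x
  have C2 := hasFDerivAt_cos_two_mul 2 x
  have h0 := ((S0.mul (C2.add_const 2)).const_mul (1 / 8)).neg.smul_const (𝐞 0)
  have h1 := ((S1.mul (C2.add_const 2)).const_mul (1 / 8)).neg.smul_const (𝐞 1)
  have h2 := ((S2.mul (C0.add C1)).const_mul (1 / 8)).neg.smul_const (𝐞 2)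
  refine ((h0.add h1).add h2).congr_fderiv ?_
  ext w i
  fin_cases i <;> simp [clmOfJac_apply, jacGrad, Fin.sum_univ_three] <;> ring

/-- **The Laplacian of the initial pressure**: `Δp = −½(cos 2x + cos 2y)(1 + cos 2z)` — T–G's (16)
for this member (`div ∇p` of the printed `p`). [cite: TaylorGreen1937, eq. (16)] -/
theorem laplacian_pressure (x : ℝ³) :
    (Δ pressure) x = -(1 / 2 * ((cos (2 * x 0) + cos (2 * x 1)) * (1 + cos (2 * x 2)))) := by
  rw [← divergence_gradient contDiff_pressure, show gradient pressure = pressureGradient from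
      funext gradient_pressure, VectorCalculus.divergence, trace_eq_sum_coord, Fin.sum_univ_three,
    (hasFDerivAt_pressureGradient x).fderiv, clmOfJac_single, clmOfJac_single, clmOfJac_single]
  simp [jacGrad]
  ring

/-- **The pressure Poisson equation (T–G (16))**: `Δp = −div((u·∇)u)` for the Taylor–Green datum
and its printed initial pressure. [cite: TaylorGreen1937, eqs. (15)–(17)] -/
theorem laplacian_pressure_eq_neg_divergence_convect (x : ℝ³) :
    (Δ pressure) x = -VectorCalculus.divergence (convect velocity velocity) x := by
  rw [laplacian_pressure, divergence_convect_velocity, Real.cos_sq]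
  ring

/-! ### The initial acceleration -/

/-- **The right-hand side of the momentum equation at `t = 0`** for the Taylor–Green datum with its
periodic initial pressure: `νΔu − ((u·∇)u + ∇p) = −3νu − (1/8)(sin 2x cos 2z, sin 2y cos 2z,
−sin 2z (cos 2x + cos 2y))` — T–G (18)–(19) for this member ("the initial value of `∂u/∂t`"): by
the momentum equation `∂ₜu = νΔu − (u·∇)u − ∇p` this is the initial time derivative of the periodic
Navier–Stokes solution, and with `ν = 0` of the Euler solution.
[cite: TaylorGreen1937, eqs. (18)–(19)] -/
theorem initialAcceleration_eq (ν : ℝ) (x : ℝ³) :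
    ν • (Δ velocity) x - (convect velocity velocity x + gradient pressure x) =
      -(3 * ν) • velocity x - projectedNonlinearity x := by
  rw [laplacian_velocity, convect_add_gradient_pressure, smul_smul, mul_neg, neg_smul, neg_smul,
    mul_comm]

/-- **The initial acceleration is divergence free** (consistency of the printed pressure:
`∂ₜ div u = 0` at `t = 0`). [cite: TaylorGreen1937, eqs. (15)–(19)] -/
theorem divergence_initialAcceleration (ν : ℝ) (x : ℝ³) :
    VectorCalculus.divergence
      (fun y => ν • (Δ velocity) y - (convect velocity velocity y + gradient pressure y)) x = 0 := by
  have e : (fun y => ν • (Δ velocity) y - (convect velocity velocity y + gradient pressure y)) =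
      fun y => (-(3 * ν)) • velocity y - projectedNonlinearity y :=
    funext fun y => initialAcceleration_eq ν y
  have h := ((hasFDerivAt_velocity x).const_smul (-(3 * ν))).sub (hasFDerivAt_projectedNonlinearity x)
  have e2 : (fun y => (-(3 * ν)) • velocity y - projectedNonlinearity y) =
      ((-(3 * ν)) • velocity - projectedNonlinearity) := rfl
  rw [e, e2, VectorCalculus.divergence, trace_eq_sum_coord, Fin.sum_univ_three, h.fderiv]
  simp [clmOfJac_single, jac, jacProj]
  ring

end TaylorGreenVortex

end Literature.Analysis.FluidPDE
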